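import Summits.AtomisticToContinuum.FouriersLaw.Theorems.PhononMeanFreePathCoherentDephasingHeadBound
import Summits.AtomisticToContinuum.FouriersLaw.Theorems.PhononMeanFreePathCoherentDephasingResponseRegularity

/-!
# Crux `PhononMeanFreePath.CoherentDephasing`, line `Sketch`: `N`-uniform ABSOLUTE bounds on the coherent field

Registered sub-goal `responseAbsBounds` of the lead's skeleton (reduction `LocalFGR`, sitewise bookkeeping). For the
`(N+1)`-site chain `pinnedChain ω₂ lam β γ` (all parameters `> 0`) with both Langevin baths at `T > 0`, and the
coherent response field `m_x = momResp`, `n_x = posResp`, `c_x = cubeResp`, `d_b = stretchCubeResp`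
(`Theorems/PhononMeanFreePathDefs`, §CoherentField), its sitewise bookkeeping `cohEnergy`, `siteWork`, `harmFlux`
(§SiteBookkeeping) is bounded by ONE constant `B(ω₂, lam, β, γ, T)`, UNIFORMLY in `N`, in the site / bond index:

  `E_x, |s_x|, ∫₀^∞ m_x², ∫₀^∞ n_x², ∫₀^∞ c_x² ≤ B` (all sites `x`),  `|j_b|, ∫₀^∞ d_b² ≤ B` (all bonds `b`).

Proof. Two `N`-uniform inputs of the tree: the dissipation bound for kick responses
`∫₀^∞ (kickResp g)² dt ≤ (T/(2γ)) ∫ g² dμ_T` (`…CoherentDephasingKickDissipation`, Bakry–Émery for the equilibrium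
semigroup) for `g ∈ {p_x, q_x, q_x³, (q_{b+1} - q_b)³}`, and the `N`-uniform Gibbs moments `∫ q_i^{2m} dμ_T ≤ C_m`
(`…CoherentDephasingHeadBound`, Brascamp–Lieb), with `∫ p_x² dμ_T = T` and `(a - c)⁶ ≤ 32 (a⁶ + c⁶)`. The composite
quantities follow from `|∫ f g| ≤ (∫ f² + ∫ g²)/2`, `(f ± g)² ≤ 2f² + 2g²` and the fact that a site meets at most
two bonds (`card_adj_le_two`); the fixed-`N` integrability of all squares is `kickResp_sq_integrableOn`
(exponential decorrelation) and the continuity in `t` of the responses (`…CoherentDephasingResponseRegularity`).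
-/

noncomputable section

open MeasureTheory Set Filter Topology

namespace Summit.AtomisticToContinuum.FouriersLaw.Theorems.CoherentDephasing.ResponseAbsBounds

open Literature.MathematicalPhysics.KineticTheory.HeatConduction
open Literature.MathematicalPhysics.KineticTheory OscillatorChain
open Summit.AtomisticToContinuum.FouriersLaw.Theorems.PhononMeanFreePath
open Summit.AtomisticToContinuum.FouriersLaw.Theorems.SubdiffusiveBondHeat
open Summit.AtomisticToContinuum.FouriersLaw.Theorems.CoherentDephasing.KickDissipation
open Summit.AtomisticToContinuum.FouriersLaw.Theorems.CoherentDephasing.HeadBound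
open Summit.AtomisticToContinuum.FouriersLaw.Theorems.CoherentDephasing.ResponseRegularity

/-! ### Elementary inequalities -/

/-- `|∫ f g dμ| ≤ (∫ f² dμ + ∫ g² dμ)/2` whenever `f², g² ∈ L¹(μ)` (pointwise AM–GM; no measurability of `f g` is
needed, the Bochner integral of a non-integrable function being `0`). [folklore] -/
theorem abs_integral_mul_le_half {μ : Measure ℝ} {f g : ℝ → ℝ} (hf : Integrable (fun t => f t ^ 2) μ)
    (hg : Integrable (fun t => g t ^ 2) μ) :
    |∫ t, f t * g t ∂μ| ≤ ((∫ t, f t ^ 2 ∂μ) + ∫ t, g t ^ 2 ∂μ) / 2 := by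
  have hb : ∀ t, ‖f t * g t‖ ≤ (f t ^ 2 + g t ^ 2) / 2 := fun t => by
    rw [Real.norm_eq_abs, abs_mul]
    nlinarith [sq_nonneg (|f t| - |g t|), sq_abs (f t), sq_abs (g t)]
  have h := norm_integral_le_of_norm_le ((hf.fun_add hg).div_const 2) (Eventually.of_forall hb)
  rwa [Real.norm_eq_abs, integral_div, integral_add hf hg] at h

/-- `(f + g)² ∈ L¹(μ)` and `∫ (f + g)² dμ ≤ 2 ∫ f² dμ + 2 ∫ g² dμ` for continuous `f`, `g` with `f², g² ∈ L¹(μ)`.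
[folklore] -/
theorem integral_add_sq_le {μ : Measure ℝ} {f g : ℝ → ℝ} (hfc : Continuous f) (hgc : Continuous g)
    (hf : Integrable (fun t => f t ^ 2) μ) (hg : Integrable (fun t => g t ^ 2) μ) :
    Integrable (fun t => (f t + g t) ^ 2) μ ∧
      ∫ t, (f t + g t) ^ 2 ∂μ ≤ 2 * (∫ t, f t ^ 2 ∂μ) + 2 * ∫ t, g t ^ 2 ∂μ := by
  have hb : ∀ t, (f t + g t) ^ 2 ≤ 2 * f t ^ 2 + 2 * g t ^ 2 := fun t => by nlinarith [sq_nonneg (f t - g t)]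
  have hI2 : Integrable (fun t => 2 * f t ^ 2 + 2 * g t ^ 2) μ := (hf.const_mul 2).add (hg.const_mul 2)
  have hm : Continuous fun t => (f t + g t) ^ 2 := by fun_prop
  have hI : Integrable (fun t => (f t + g t) ^ 2) μ :=
    hI2.mono' hm.aestronglyMeasurable (Eventually.of_forall fun t => by
      rw [Real.norm_eq_abs, abs_of_nonneg (sq_nonneg _)]; exact hb t)
  refine ⟨hI, (integral_mono hI hI2 hb).trans_eq ?_⟩
  rw [integral_add (hf.const_mul 2) (hg.const_mul 2), integral_const_mul, integral_const_mul]

/-- `(f - g)² ∈ L¹(μ)` and `∫ (f - g)² dμ ≤ 2 ∫ f² dμ + 2 ∫ g² dμ` for continuous `f`, `g` with `f², g² ∈ L¹(μ)`.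
[folklore] -/
theorem integral_sub_sq_le {μ : Measure ℝ} {f g : ℝ → ℝ} (hfc : Continuous f) (hgc : Continuous g)
    (hf : Integrable (fun t => f t ^ 2) μ) (hg : Integrable (fun t => g t ^ 2) μ) :
    Integrable (fun t => (f t - g t) ^ 2) μ ∧
      ∫ t, (f t - g t) ^ 2 ∂μ ≤ 2 * (∫ t, f t ^ 2 ∂μ) + 2 * ∫ t, g t ^ 2 ∂μ := by
  have hb : ∀ t, (f t - g t) ^ 2 ≤ 2 * f t ^ 2 + 2 * g t ^ 2 := fun t => by nlinarith [sq_nonneg (f t + g t)]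
  have hI2 : Integrable (fun t => 2 * f t ^ 2 + 2 * g t ^ 2) μ := (hf.const_mul 2).add (hg.const_mul 2)
  have hm : Continuous fun t => (f t - g t) ^ 2 := by fun_prop
  have hI : Integrable (fun t => (f t - g t) ^ 2) μ :=
    hI2.mono' hm.aestronglyMeasurable (Eventually.of_forall fun t => by
      rw [Real.norm_eq_abs, abs_of_nonneg (sq_nonneg _)]; exact hb t)
  refine ⟨hI, (integral_mono hI hI2 hb).trans_eq ?_⟩
  rw [integral_add (hf.const_mul 2) (hg.const_mul 2), integral_const_mul, integral_const_mul]

/-- `((a - c)³)² = (a - c)⁶ ≤ 32 (a⁶ + c⁶)`. [folklore] -/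
theorem stretch_cube_sq_le (a c : ℝ) : ((a - c) ^ 3) ^ 2 ≤ 32 * (a ^ 6 + c ^ 6) := by
  have hr2 : (a - c) ^ 2 ≤ 2 * (a ^ 2 + c ^ 2) := by nlinarith [sq_nonneg (a + c)]
  have h1 : ((a - c) ^ 2) ^ 3 ≤ (2 * (a ^ 2 + c ^ 2)) ^ 3 := pow_le_pow_left₀ (sq_nonneg _) hr2 3
  have ha : 0 ≤ a ^ 2 := sq_nonneg a
  have hc : 0 ≤ c ^ 2 := sq_nonneg c
  have h2 : (a ^ 2 + c ^ 2) ^ 3 ≤ 4 * ((a ^ 2) ^ 3 + (c ^ 2) ^ 3) := by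
    nlinarith [mul_nonneg (add_nonneg ha hc) (sq_nonneg (a ^ 2 - c ^ 2))]
  calc ((a - c) ^ 3) ^ 2 = ((a - c) ^ 2) ^ 3 := by ring
    _ ≤ (2 * (a ^ 2 + c ^ 2)) ^ 3 := h1
    _ = 8 * (a ^ 2 + c ^ 2) ^ 3 := by ring
    _ ≤ 8 * (4 * ((a ^ 2) ^ 3 + (c ^ 2) ^ 3)) := by linarith
    _ = 32 * (a ^ 6 + c ^ 6) := by ring

/-! ### A site of the chain meets at most two bonds -/

/-- At most two bonds `b : Fin N` are adjacent to a site `x : Fin (N+1)` (`b = x` or `b + 1 = x` as naturals).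
[folklore] -/
theorem card_adj_le_two (N : ℕ) (x : Fin (N + 1)) :
    (Finset.univ.filter (fun b : Fin N => (b : ℕ) = (x : ℕ) ∨ (b : ℕ) + 1 = (x : ℕ))).card ≤ 2 := by
  rw [Finset.filter_or]
  have h1 : (Finset.univ.filter (fun b : Fin N => (b : ℕ) = (x : ℕ))).card ≤ 1 :=
    Finset.card_le_one.2 fun a ha b hb => by
      simp only [Finset.mem_filter, Finset.mem_univ, true_and] at ha hb
      exact Fin.ext (by omega)
  have h2 : (Finset.univ.filter (fun b : Fin N => (b : ℕ) + 1 = (x : ℕ))).card ≤ 1 :=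
    Finset.card_le_one.2 fun a ha b hb => by
      simp only [Finset.mem_filter, Finset.mem_univ, true_and] at ha hb
      exact Fin.ext (by omega)
  exact (Finset.card_union_le _ _).trans (Nat.add_le_add h1 h2)

/-- Summing a constant `c ≥ 0` over the bonds adjacent to a site gives at most `2c`. [folklore] -/
theorem sum_adj_le (N : ℕ) (x : Fin (N + 1)) {c : ℝ} (hc : 0 ≤ c) :
    ∑ b : Fin N, (if (b : ℕ) = (x : ℕ) ∨ (b : ℕ) + 1 = (x : ℕ) then c else 0) ≤ 2 * c := by
  have h : ∀ b : Fin N, (if (b : ℕ) = (x : ℕ) ∨ (b : ℕ) + 1 = (x : ℕ) then c else 0) =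
      c * (if (b : ℕ) = (x : ℕ) ∨ (b : ℕ) + 1 = (x : ℕ) then 1 else 0) := fun b => by
    split_ifs <;> simp
  simp_rw [h, ← Finset.mul_sum, Finset.sum_boole]
  calc _ ≤ c * 2 := by gcongr; exact_mod_cast card_adj_le_two N x
    _ = 2 * c := mul_comm _ _

/-! ### The stub -/

/-- **responseAbsBounds** (registered sub-goal of line `Sketch`, crux `PhononMeanFreePath.CoherentDephasing`).
For `ω₂, lam, β, γ, T > 0` there is ONE constant `B` such that for every `N`, every site `x` and every bond `b` of
the `(N+1)`-site chain: `cohEnergy x ≤ B`, `|siteWork x| ≤ B`, `∫₀^∞ m_x² ≤ B`, `∫₀^∞ n_x² ≤ B`, `∫₀^∞ c_x² ≤ B`,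
`|harmFlux b| ≤ B`, `∫₀^∞ d_b² ≤ B`. The squares are bounded by the `N`-uniform dissipation inequality
`∫₀^∞ (kickResp g)² ≤ (T/(2γ)) ∫ g² dμ_T` and the `N`-uniform Gibbs moments; the composite quantities by
`|∫ fg| ≤ (∫f² + ∫g²)/2`, `(f ± g)² ≤ 2f² + 2g²` and `card_adj_le_two`. [folklore] -/
theorem responseAbsBounds : ∀ ω₂ lam β γ : ℝ, 0 < ω₂ → 0 < lam → 0 < β → 0 < γ → ∀ T : ℝ, 0 < T →
    ∃ B : ℝ, ∀ N : ℕ, (∀ x : Fin (N + 1), cohEnergy ω₂ lam β γ T N x ≤ B ∧ |siteWork ω₂ lam β γ T N x| ≤ B ∧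
      (∫ t in Ioi (0 : ℝ), momResp ω₂ lam β γ T N x t ^ 2) ≤ B ∧
      (∫ t in Ioi (0 : ℝ), posResp ω₂ lam β γ T N x t ^ 2) ≤ B ∧
      (∫ t in Ioi (0 : ℝ), cubeResp ω₂ lam β γ T N x t ^ 2) ≤ B) ∧
      (∀ b : Fin N, |harmFlux ω₂ lam β γ T N b| ≤ B ∧
        (∫ t in Ioi (0 : ℝ), stretchCubeResp ω₂ lam β γ T N b t ^ 2) ≤ B) := by
  intro ω₂ lam β γ hω hl hβ hγ T hT
  -- `N`-uniform Gibbs moments `∫ q² ≤ C₁`, `∫ q⁶ ≤ C₃`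
  obtain ⟨C₁, hC₁⟩ := gibbs_position_moment_le hω hl.le hβ.le γ hT 1
  obtain ⟨C₃, hC₃⟩ := gibbs_position_moment_le hω hl.le hβ.le γ hT 3
  have hC2 : ∀ (n : ℕ) (i : Fin n), ∫ y, (y.1 i) ^ 2 ∂((pinnedChain ω₂ lam β γ).gibbsMeasure n T) ≤ C₁ :=
    fun n i => by simpa using hC₁ n i
  have hC6 : ∀ (n : ℕ) (i : Fin n), ∫ y, (y.1 i) ^ 6 ∂((pinnedChain ω₂ lam β γ).gibbsMeasure n T) ≤ C₃ :=
    fun n i => by simpa using hC₃ n i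
  have hC₁0 : 0 ≤ C₁ :=
    (integral_nonneg (μ := (pinnedChain ω₂ lam β γ).gibbsMeasure 1 T)
      fun y : PhaseSpace 1 => even_two.pow_nonneg (y.1 0)).trans (hC2 1 0)
  have hC₃0 : 0 ≤ C₃ :=
    (integral_nonneg (μ := (pinnedChain ω₂ lam β γ).gibbsMeasure 1 T)
      fun y : PhaseSpace 1 => (by decide : Even 6).pow_nonneg (y.1 0)).trans (hC6 1 0)
  -- the constants
  set K : ℝ := T / (2 * γ) with hK
  have hK0 : 0 ≤ K := by positivity
  set Bm : ℝ := K * T with hBm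
  set Bn : ℝ := K * C₁ with hBn
  set Bc : ℝ := K * C₃ with hBc
  set Bd : ℝ := K * (32 * (C₃ + C₃)) with hBd
  have hBm0 : 0 ≤ Bm := by positivity
  have hBn0 : 0 ≤ Bn := by positivity
  have hBc0 : 0 ≤ Bc := by positivity
  have hBd0 : 0 ≤ Bd := by positivity
  set B : ℝ := Bm + Bn + Bc + Bd + ((Bm + ω₂ * Bn) / 2 + 2 * Bn) +
    (lam * ((Bm + Bc) / 2) + β * (2 * ((Bm + Bd) / 2))) + (Bm + Bn) with hB
  have hω0 : 0 ≤ ω₂ := hω.le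
  have hP1 : 0 ≤ ω₂ * Bn := by positivity
  have hP2 : 0 ≤ lam * ((Bm + Bc) / 2) := by positivity
  have hP3 : 0 ≤ β * (2 * ((Bm + Bd) / 2)) := by positivity
  refine ⟨B, fun N => ?_⟩
  have hϑ0 : (0 : ℝ) < 1 / (4 * T) := by positivity
  have h2ϑ : 2 * (1 / (4 * T)) < 1 / T := by
    rw [show 2 * (1 / (4 * T)) = 1 / (2 * T) by field_simp; ring, div_lt_div_iff₀ (by positivity) hT]
    nlinarith
  -- the four families of responses: continuity, square-integrability in time, `N`-uniform bounds
  have Fm : ∀ x : Fin (N + 1), Continuous (momResp ω₂ lam β γ T N x) ∧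
      IntegrableOn (fun t => momResp ω₂ lam β γ T N x t ^ 2) (Ioi 0) ∧
      ∫ t in Ioi (0 : ℝ), momResp ω₂ lam β γ T N x t ^ 2 ≤ Bm := fun x => by
    have hgc : Continuous fun y : PhaseSpace (N + 1) => y.2 x := by fun_prop
    have hgB := fun y : PhaseSpace (N + 1) =>
      CoherentDephasing.abs_momentum_le_exp (γ := γ) hω.le hl.le hβ.le hϑ0 y x
    refine ⟨(continuous_kickResp_and_exp_decay hω hl.le hβ hγ hT N hϑ0 h2ϑ hgc hgB).1,
      kickResp_sq_integrableOn hω hl.le hβ hγ hT N hgc hgB, ?_⟩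
    have h := integral_kickResp_sq_le hω hl.le hβ hγ hT N hgc hgB
    rwa [pinnedChain_integral_momentum_sq_gibbsMeasure hω hl.le hβ.le (N + 1) hT x] at h
  have Fn : ∀ x : Fin (N + 1), Continuous (posResp ω₂ lam β γ T N x) ∧
      IntegrableOn (fun t => posResp ω₂ lam β γ T N x t ^ 2) (Ioi 0) ∧
      ∫ t in Ioi (0 : ℝ), posResp ω₂ lam β γ T N x t ^ 2 ≤ Bn := fun x => by
    obtain ⟨M, hgB⟩ := exists_abs_pos_le_exp hω hl.le hβ.le (γ := γ) (n := N + 1) hϑ0 x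
    have hgc : Continuous fun y : PhaseSpace (N + 1) => y.1 x := by fun_prop
    refine ⟨(continuous_kickResp_and_exp_decay hω hl.le hβ hγ hT N hϑ0 h2ϑ hgc hgB).1,
      kickResp_sq_integrableOn hω hl.le hβ hγ hT N hgc hgB, ?_⟩
    exact (integral_kickResp_sq_le hω hl.le hβ hγ hT N hgc hgB).trans
      (mul_le_mul_of_nonneg_left (hC2 (N + 1) x) hK0)
  have Fc : ∀ x : Fin (N + 1), IntegrableOn (fun t => cubeResp ω₂ lam β γ T N x t ^ 2) (Ioi 0) ∧
      ∫ t in Ioi (0 : ℝ), cubeResp ω₂ lam β γ T N x t ^ 2 ≤ Bc := fun x => by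
    obtain ⟨M, hgB⟩ := exists_abs_pos_cube_le_exp hω hl.le hβ.le (γ := γ) (n := N + 1) hϑ0 x
    have hgc : Continuous fun y : PhaseSpace (N + 1) => y.1 x ^ 3 := by fun_prop
    refine ⟨kickResp_sq_integrableOn hω hl.le hβ hγ hT N hgc hgB, ?_⟩
    have h := integral_kickResp_sq_le hω hl.le hβ hγ hT N hgc hgB
    have h6 : ∫ y, (y.1 x ^ 3) ^ 2 ∂((pinnedChain ω₂ lam β γ).gibbsMeasure (N + 1) T) =
        ∫ y, y.1 x ^ 6 ∂((pinnedChain ω₂ lam β γ).gibbsMeasure (N + 1) T) :=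
      integral_congr_ae (Eventually.of_forall fun y => by ring)
    rw [h6] at h
    exact h.trans (mul_le_mul_of_nonneg_left (hC6 (N + 1) x) hK0)
  have Fd : ∀ b : Fin N, IntegrableOn (fun t => stretchCubeResp ω₂ lam β γ T N b t ^ 2) (Ioi 0) ∧
      ∫ t in Ioi (0 : ℝ), stretchCubeResp ω₂ lam β γ T N b t ^ 2 ≤ Bd := fun b => by
    obtain ⟨M, hgB⟩ := exists_abs_stretch_cube_le_exp hω hl.le hβ.le (γ := γ) (n := N + 1) hϑ0
      b.succ b.castSucc
    have hgc : Continuous fun y : PhaseSpace (N + 1) => (y.1 b.succ - y.1 b.castSucc) ^ 3 := by fun_prop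
    refine ⟨kickResp_sq_integrableOn hω hl.le hβ hγ hT N hgc hgB, ?_⟩
    have h := integral_kickResp_sq_le hω hl.le hβ hγ hT N hgc hgB
    have hI6 := fun i => integrable_position_pow hω hl.le hβ.le γ hT 6 (N + 1) i
    have h6 : ∫ y, ((y.1 b.succ - y.1 b.castSucc) ^ 3) ^ 2 ∂((pinnedChain ω₂ lam β γ).gibbsMeasure (N + 1) T) ≤
        32 * (C₃ + C₃) := by
      calc ∫ y, ((y.1 b.succ - y.1 b.castSucc) ^ 3) ^ 2 ∂((pinnedChain ω₂ lam β γ).gibbsMeasure (N + 1) T)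
          ≤ ∫ y, 32 * (y.1 b.succ ^ 6 + y.1 b.castSucc ^ 6) ∂((pinnedChain ω₂ lam β γ).gibbsMeasure (N + 1) T) :=
            integral_mono_of_nonneg (ae_of_all _ fun y => sq_nonneg _)
              (((hI6 b.succ).fun_add (hI6 b.castSucc)).const_mul 32)
              (ae_of_all _ fun y => stretch_cube_sq_le (y.1 b.succ) (y.1 b.castSucc))
        _ = 32 * ((∫ y, y.1 b.succ ^ 6 ∂((pinnedChain ω₂ lam β γ).gibbsMeasure (N + 1) T)) +
              ∫ y, y.1 b.castSucc ^ 6 ∂((pinnedChain ω₂ lam β γ).gibbsMeasure (N + 1) T)) := by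
            rw [integral_const_mul, integral_add (hI6 b.succ) (hI6 b.castSucc)]
        _ ≤ 32 * (C₃ + C₃) := by gcongr <;> exact hC6 (N + 1) _
    exact h.trans (mul_le_mul_of_nonneg_left h6 hK0)
  refine ⟨fun x => ⟨?_, ?_, (Fm x).2.2.trans (by linarith), (Fn x).2.2.trans (by linarith),
    (Fc x).2.trans (by linarith)⟩, fun b => ⟨?_, (Fd b).2.trans (by linarith)⟩⟩
  · -- the coherent site energy `E_x ≤ (Bm + ω₂ Bn)/2 + 2 Bn`
    have hs : ∀ b : Fin N, IntegrableOn (fun t => (posResp ω₂ lam β γ T N b.succ t -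
        posResp ω₂ lam β γ T N b.castSucc t) ^ 2) (Ioi 0) ∧
        ∫ t in Ioi (0 : ℝ), (posResp ω₂ lam β γ T N b.succ t - posResp ω₂ lam β γ T N b.castSucc t) ^ 2 ≤
          4 * Bn := fun b => by
      have h := integral_sub_sq_le (Fn b.succ).1 (Fn b.castSucc).1 (Fn b.succ).2.1 (Fn b.castSucc).2.1
      exact ⟨h.1, h.2.trans (by linarith [(Fn b.succ).2.2, (Fn b.castSucc).2.2])⟩
    have hite : ∀ b : Fin N, IntegrableOn (fun t => if (b : ℕ) = (x : ℕ) ∨ (b : ℕ) + 1 = (x : ℕ) then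
        (posResp ω₂ lam β γ T N b.succ t - posResp ω₂ lam β γ T N b.castSucc t) ^ 2 else 0) (Ioi 0) := by
      intro b
      by_cases hc : (b : ℕ) = (x : ℕ) ∨ (b : ℕ) + 1 = (x : ℕ)
      · simp only [if_pos hc]; exact (hs b).1
      · simp only [if_neg hc]; exact integrableOn_zero
    have h1 : IntegrableOn (fun t => (momResp ω₂ lam β γ T N x t ^ 2 + ω₂ * posResp ω₂ lam β γ T N x t ^ 2) / 2)
        (Ioi 0) := ((Fm x).2.1.add ((Fn x).2.1.const_mul ω₂)).div_const 2
    have h2 : IntegrableOn (fun t => (1 / 4) * ∑ b : Fin N, (if (b : ℕ) = (x : ℕ) ∨ (b : ℕ) + 1 = (x : ℕ) then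
        (posResp ω₂ lam β γ T N b.succ t - posResp ω₂ lam β γ T N b.castSucc t) ^ 2 else 0)) (Ioi 0) :=
      (integrable_finsetSum Finset.univ fun b _ => hite b).const_mul (1 / 4)
    have hsplit : cohEnergy ω₂ lam β γ T N x =
        (∫ t in Ioi (0 : ℝ), (momResp ω₂ lam β γ T N x t ^ 2 + ω₂ * posResp ω₂ lam β γ T N x t ^ 2) / 2) +
          ∫ t in Ioi (0 : ℝ), (1 / 4) * ∑ b : Fin N, (if (b : ℕ) = (x : ℕ) ∨ (b : ℕ) + 1 = (x : ℕ) then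
            (posResp ω₂ lam β γ T N b.succ t - posResp ω₂ lam β γ T N b.castSucc t) ^ 2 else 0) := by
      unfold cohEnergy cohEnergyDensity
      exact integral_add h1 h2
    have hfirst : ∫ t in Ioi (0 : ℝ), (momResp ω₂ lam β γ T N x t ^ 2 + ω₂ * posResp ω₂ lam β γ T N x t ^ 2) / 2 ≤
        (Bm + ω₂ * Bn) / 2 := by
      rw [integral_div, integral_add (Fm x).2.1 ((Fn x).2.1.const_mul ω₂), integral_const_mul]
      gcongr
      · exact (Fm x).2.2
      · exact (Fn x).2.2
    have hterm : ∀ b : Fin N, ∫ t in Ioi (0 : ℝ), (if (b : ℕ) = (x : ℕ) ∨ (b : ℕ) + 1 = (x : ℕ) then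
        (posResp ω₂ lam β γ T N b.succ t - posResp ω₂ lam β γ T N b.castSucc t) ^ 2 else 0) ≤
        if (b : ℕ) = (x : ℕ) ∨ (b : ℕ) + 1 = (x : ℕ) then 4 * Bn else 0 := by
      intro b
      by_cases hc : (b : ℕ) = (x : ℕ) ∨ (b : ℕ) + 1 = (x : ℕ)
      · simp only [if_pos hc]; exact (hs b).2
      · simp [if_neg hc]
    have hsecond : ∫ t in Ioi (0 : ℝ), (1 / 4) * ∑ b : Fin N, (if (b : ℕ) = (x : ℕ) ∨ (b : ℕ) + 1 = (x : ℕ) then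
        (posResp ω₂ lam β γ T N b.succ t - posResp ω₂ lam β γ T N b.castSucc t) ^ 2 else 0) ≤
        (1 / 4) * (2 * (4 * Bn)) := by
      rw [integral_const_mul, integral_finsetSum _ (fun b _ => hite b)]
      gcongr
      exact (Finset.sum_le_sum fun b _ => hterm b).trans (sum_adj_le N x (by positivity))
    rw [hsplit]
    exact (add_le_add hfirst hsecond).trans (by linarith)
  · -- the site work `|s_x| ≤ lam (Bm + Bc)/2 + 2β (Bm + Bd)/2`
    have hI0 : |∫ t in Ioi (0 : ℝ), momResp ω₂ lam β γ T N x t * cubeResp ω₂ lam β γ T N x t| ≤ (Bm + Bc) / 2 :=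
      (abs_integral_mul_le_half (Fm x).2.1 (Fc x).1).trans (by linarith [(Fm x).2.2, (Fc x).2])
    have hIb : ∀ b : Fin N,
        |∫ t in Ioi (0 : ℝ), momResp ω₂ lam β γ T N x t * stretchCubeResp ω₂ lam β γ T N b t| ≤ (Bm + Bd) / 2 :=
      fun b => (abs_integral_mul_le_half (Fm x).2.1 (Fd b).1).trans (by linarith [(Fm x).2.2, (Fd b).2])
    have hW0 : 0 ≤ (Bm + Bd) / 2 := by positivity
    have hterm : ∀ b : Fin N,
        |((if (b : ℕ) + 1 = (x : ℕ) then (1 : ℝ) else 0) - (if (b : ℕ) = (x : ℕ) then 1 else 0)) *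
          ∫ t in Ioi (0 : ℝ), momResp ω₂ lam β γ T N x t * stretchCubeResp ω₂ lam β γ T N b t| ≤
        if (b : ℕ) = (x : ℕ) ∨ (b : ℕ) + 1 = (x : ℕ) then (Bm + Bd) / 2 else 0 := by
      intro b
      rw [abs_mul]
      have hb := hIb b
      by_cases h1 : (b : ℕ) = (x : ℕ)
      · by_cases h2 : (b : ℕ) + 1 = (x : ℕ)
        · exfalso; omega
        · rw [if_neg h2, if_pos h1, if_pos (Or.inl h1)]; simpa using hb
      · by_cases h2 : (b : ℕ) + 1 = (x : ℕ)
        · rw [if_pos h2, if_neg h1, if_pos (Or.inr h2)]; simpa using hb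
        · rw [if_neg h2, if_neg h1, if_neg (not_or.mpr ⟨h1, h2⟩)]; simp
    have hsum : |∑ b : Fin N, ((if (b : ℕ) + 1 = (x : ℕ) then (1 : ℝ) else 0) - (if (b : ℕ) = (x : ℕ) then 1 else 0)) *
        ∫ t in Ioi (0 : ℝ), momResp ω₂ lam β γ T N x t * stretchCubeResp ω₂ lam β γ T N b t| ≤
        2 * ((Bm + Bd) / 2) :=
      (Finset.abs_sum_le_sum_abs _ _).trans
        ((Finset.sum_le_sum fun b _ => hterm b).trans (sum_adj_le N x hW0))
    unfold siteWork
    refine (abs_add_le _ _).trans ?_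
    rw [abs_mul, abs_mul, abs_of_pos hl, abs_of_pos hβ]
    exact (add_le_add (mul_le_mul_of_nonneg_left hI0 hl.le) (mul_le_mul_of_nonneg_left hsum hβ.le)).trans
      (by linarith)
  · -- the symmetric harmonic flux `|j_b| ≤ Bm + Bn`
    have hm2 := integral_add_sq_le (Fm b.castSucc).1 (Fm b.succ).1 (Fm b.castSucc).2.1 (Fm b.succ).2.1
    have hn2 := integral_sub_sq_le (Fn b.succ).1 (Fn b.castSucc).1 (Fn b.succ).2.1 (Fn b.castSucc).2.1
    have hprod : |∫ t in Ioi (0 : ℝ), (momResp ω₂ lam β γ T N b.castSucc t + momResp ω₂ lam β γ T N b.succ t) *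
        (posResp ω₂ lam β γ T N b.succ t - posResp ω₂ lam β γ T N b.castSucc t)| ≤ (4 * Bm + 4 * Bn) / 2 :=
      (abs_integral_mul_le_half hm2.1 hn2.1).trans (by
        linarith [hm2.2, hn2.2, (Fm b.castSucc).2.2, (Fm b.succ).2.2, (Fn b.succ).2.2, (Fn b.castSucc).2.2])
    unfold harmFlux
    rw [abs_mul, abs_neg, abs_of_pos (by norm_num : (0 : ℝ) < 1 / 2)]
    linarith

end Summit.AtomisticToContinuum.FouriersLaw.Theorems.CoherentDephasing.ResponseAbsBounds

end
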